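import Summits.BirchSwinnertonDyer.Rank1Residual.X2.NonsplitHalves
import Summits.BirchSwinnertonDyer.Rank1Residual.X2.RankOneManin
import Summits.BirchSwinnertonDyer.Rank1Residual.X11b.EmbeddingDatumPrime
import Summits.BirchSwinnertonDyer.Rank1Residual.X11b.Three.HsiehDisplayGlue
import Literature.NumberTheory.EllipticCurves.AnticyclotomicRankinSelbergPAdicLFunction
import Literature.FieldTheory.AlgClosed.PadicAlgClEquivComplex
import HarnessLib

/-!
# O9 ∩ {non-split}: the EXISTENCE half of the frame — Hsieh 2014 Thm. 1 (tree fact, odd `p`,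
# `p² ∤ N`, NO image hypothesis) + ONE named residual `X2.HsiehFrameResidualAt W p` (the
# `R₀`-descent of Hsieh's witness, uniform in the odd prime `p`) ⟹ a frame `L ∈ R₀⟦T⟧` with
# `IsBDPLFunction` at every X2 ∩ {non-split} Heegner datum; and `BSD(E,p)` on `CellCNonsplitNotGV`
# from the two halves H2/H3 quantified over THAT frame (cell `bsd-eis`, seat `bsd-eis-cgshw`;
# TARGET §1.3 ROUTING v1.4 (3)(b1) / v1.5 (6) / v1.8.10: "the Hsieh existence glue")

HONEST FRAMING (cell `bsd-eis`): theorems + ONE `@[conjecture]`-tagged hypothesis-shaped residual and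
two hypothesis-shaped halves; nothing booked; X2 stays CONSTRUCTION-SHAPED; no label moves. The
halves file `X2/NonsplitHalves.lean` leaves the frame `L` universally quantified: a consumer must
PRODUCE an `L` carrying H2 ∧ H3. The only typed EXISTENCE statement in the tree, Castella 2018
Thm. 3.1 (`castella2018_exists_isBDPLFunction`), binds `5 ≤ p → Squarefree N → E[p] irreducible`
and so can never be instantiated on X2 (planner finding F1, TARGET §1.3 ROUTING v1.4 (2)). The road
(b1) is team x11b3's S18(b) (`X11b/Three/BDPExistsFromPrint.lean`) made uniform in the odd prime:

* **`HsiehFrameResidualAt W p`** (`@[conjecture]`, hypothesis-shaped; the ONE named residual) —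
  `X11b.Three.HsiehFrameResidualAt₃` with `ClassX11b W 3 → Surj W 3` replaced by the X2 ∩ {non-split}
  binder `ClassX2 W p → ¬ split` and `3 ↦ p`: over `(ι', K, 𝔭, κ, γ, f)` with the CGLS clauses
  (`K` imaginary quadratic, classical Heegner hypothesis for `N = N_E` — so `p ∣ N` splits —, `𝔭 ∋ p`
  of degree one, `ι'` inducing `𝔭`, `κ` anticyclotomic with generator `γ`): (λ) an auxiliary Hecke
  character `λ` of `K` (unitary, type `(1,−1)`, trivial on `𝔸_ℚ^×`, unramified outside `p`) with a
  `p`-adic avatar through `κ`, AND for every Hsieh witness `(A, Ω_K, C, Ω_p, Q)` for `λ` (the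
  conclusion of `hsieh2014_exists_anticyclotomicPAdicLFunction` verbatim) an `R₀`-frame
  `(Ω_K' ≠ 0, Ω_p' ∈ R₀ˣ, L ∈ R₀⟦T⟧)` realising Hsieh's display with constant `1` — "Hsieh's element
  `Q ∈ Z̄_p⟦Γ⁻⟧`, period `Ω_p ∈ Z̄_p^×`, unit `C` are `R₀ = 𝒪(ℚ̂_p^ur)`-rational up to the admissible
  re-normalisation" (printed only by Castella–Hsieh 2018 Def. 3.5 for `p ∤ N` and Castella 2018
  Thm. 3.1 for `p ≥ 5`, `E[p]` irreducible, semistable). ONE residual, uniform in `p ∈ {3, 5, 7, …}`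
  (planner: "(b1) THE road at every prime"). NOTHING of it is asserted.
* **`exists_isBDPLFunction_of_hsiehDisplay`** — the x11b3 glue (g1) at a general prime: an
  `R₀`-frame in Hsieh's display ⟹ `IsBDPLFunction ι' 𝔭 κ γ f Ω_K₁ Ω_p' L` with
  `Ω_K₁ = (16A²/p)^{1/4}·Ω_K'` (the real monomial `(p/(16A²))^{n}` absorbed by the complex period;
  `hsiehInterpolationValue_eq_bdpInterpolationValue_rescale` is already stated for every `p`).
* **`exists_isBDPLFunction_of_hsieh2014_of_not_split`** — Hsieh's fact (odd `p`, `p² ∤ N` from `Mult`,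
  `p` split from the Heegner hypothesis since `p ∣ N`) + the residual ⟹ at every X2 ∩ {non-split}
  datum `∃ Ω_K ≠ 0, Ω_p ∈ R₀ˣ, L ∈ R₀⟦T⟧, IsBDPLFunction ι' 𝔭 κ γ f Ω_K Ω_p L` — H1 DISCHARGED modulo
  (fact, residual), with NO irreducibility, NO square-freeness, NO `p ≥ 5`.
* **`NonsplitBDPValueOnTree W p`** (H2, hypothesis-shaped, PUB shape at `p ≥ 5` both signs per
  LIT-DOSSIER §2d(a)/§2e; NOT in print at `p = 3 ‖ N`) and **`NonsplitIMCEqOnTree W p`** (H3,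
  hypothesis-shaped, Keller–Yin Thm. D = v2 5.1.3 SHAPE for that `L`: PREPRINT WITH GAP at L1754 —
  the text proves D′ (μ = 0, λ-equality, Kolyvagin-free); char-ideal form = D′ + (α) [+ (d)
  GAP(hypothesis) above weight `p+1`, C–H (H)(a) failing already at `p+1`] or D′ + R-β; per pair D′
  suffices when `ord_p log_ω P_K = 1` — bsd-eis-ky MEMO-2 / TARGET §1.3 ROUTING v1.4 (2) H3
  docstring rule): the X11b `R1.BDPValueOnTree` / `R1.IMCEqOnTree` universal shapes re-typed over the
  X2 ∩ {non-split} Heegner datum, quantified over every frame `(ι', Ω_K, Ω_p, L)` with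
  `IsBDPLFunction`. (HK): both inherit `p ∤ h_K` AS PRINTED via [Cas20] Def. 1.3 (U1); removable by
  R-hK (unwritten) — TARGET §1.3 ROUTING v1.5 (4) DOCSTRING RULE, declared here.
* the ASSEMBLY (`BSD(E,p)` at a Heegner datum from print + residual + H2 + H3, ψ even; either
  parity with the partner's `PPartRankZero`) is the companion file `X2/NonsplitHalvesOnTree.lean`
  (kept separate: this file carries the definitions, that one only theorems).

So on `CellCNonsplitNotGV` (2 552 @3 + 93 @5 + 17 @7 classes, GVPAR-SUMMARY) the residual inputs are
now ALL NAMED: {Hsieh 2014 Thm. 1 (PUB), `HsiehFrameResidualAt` (R₀-descent, unprinted at `p ∣ N`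
reducible), H2 (PUB shape `p ≥ 5` / open `p = 3`), H3 (KY Thm. D shape, PRE with the L1754 gap)};
control and Tamagawa links are theorems (p398508 / p398550). CONDITIONAL on every listed binder.

References: [Hsieh2014] Thm. 1 (arXiv:1112.1580 pp. 3–4); [CastellaHsieh2018] Def. 3.5, Prop. 3.6
(arXiv:1505.08165 pp. 10–11); [Castella2018] Thm. 2.3, Thm. 3.1, Thm. 3.2, §5 (arXiv:1704.06608
pp. 5, 9, 12); [Castella2018Exceptional] Thm. 2.11 (arXiv:1507.04260); [KellerYin2024] Thm. D;
[CastellaEtAl2021] Thm. 5.3.1; [Miller2011LMS] Def. 1.1.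
-/

set_option autoImplicit false

noncomputable section

open scoped Classical MatrixGroups ModularForm

open CongruenceSubgroup WeierstrassCurve NumberField IsDedekindDomain Field PowerSeries
  Literature.NumberTheory.EllipticCurves Literature.NumberTheory.EllipticCurves.GreenbergSelmer
  Literature.NumberTheory.EllipticCurves.ModularForms
  Literature.NumberTheory.EllipticCurves.Rank1Residual
  Literature.NumberTheory.EllipticCurves.Rank1Residual.Typed
  Literature.NumberTheory.EllipticCurves.GreenbergVatsal2000
  Literature.NumberTheory.EllipticCurves.Wuthrich2014
  Literature.NumberTheory.EllipticCurves.SteinWuthrich2013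
  Literature.NumberTheory.GaloisRepresentations Literature.NumberTheory.GaloisCohomology
  Literature.NumberTheory.Automorphic
  Summit.BirchSwinnertonDyer.Rank1Residual.X11b.AcSelmer
  Summit.BirchSwinnertonDyer.Rank1Residual.X11b.Halves
  Summit.BirchSwinnertonDyer.Rank1Residual.X11b

namespace Summit.BirchSwinnertonDyer.Rank1Residual.X2

/-! ### The named residual: `R₀`-rationality of (a re-normalisation of) Hsieh's witness, odd `p` -/

section Residual

variable (W : WeierstrassCurve ℚ) [W.IsElliptic] [W.IsGloballyMinimal] (p : ℕ) [Fact p.Prime]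

/-- **`HsiehFrameResidualAt W p` — "Hsieh's printed element lands in the tree's frame", at an X2 ∩
{non-split} datum, uniform in the odd prime `p`** (hypothesis-shaped; the ONE named residual of road
(b1); `X11b.Three.HsiehFrameResidualAt₃` with `ClassX11b W 3 → Surj W 3 ↦ ClassX2 W p → ¬ split` and
`3 ↦ p`). Over `ι' : ℚ̄_p ≃ ℂ`, `K, 𝔭, κ, γ`, the newform `f ∈ S_2(Γ₀(N))` of `E` with `N = N_E`,
`ClassX2 W p` (`p ≠ 2`, `E[p]` reducible, `p` multiplicative), `p` NON-split multiplicative, `K`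
imaginary quadratic with the classical Heegner hypothesis for `N` (so `p ∣ N` splits in `K`), `𝔭 ∋ p`
with `e = f = 1`, `ι'` inducing `𝔭` (Castella 2018 Thm. 3.1's compatibility clause), `κ`
anticyclotomic with generator `γ`: (λ) there is an auxiliary Hecke character `λ` of `K` (unitary,
tree infinity type `(1, −1)`, trivial on `𝔸_ℚ^×`, unramified outside `p`) with a `p`-adic avatar
`r_λ` (`IsPAdicAvatarOf ι' λ r_λ`) factoring through `κ` (`FactorsThroughZp κ r_λ`) — Castella's `ψ`
[arXiv:1704.06608 p. 9 l. 42] taken through `Γ⁻` (folklore, not typed) —, AND for every Hsieh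
witness `(A, Ω_K, C, Ω_p, Q)` for `λ` (`0 < A`, `Ω_K ≠ 0`, `‖ι'⁻¹C‖ = 1`, `‖Ω_p‖ = 1`,
`IsHsiehLFunction ι' 𝔭 κ γ f A Ω_K C Ω_p Q` — the conclusion of
`hsieh2014_exists_anticyclotomicPAdicLFunction` verbatim) there is an `R₀`-frame `Ω_K' ≠ 0`,
`Ω_p' ∈ R₀ˣ`, `L ∈ R₀⟦T⟧` taking at every unramified `χ` of tree type `(n, −n)`, `n > 0`, with
avatar `r` through `κ`, the value `ι'⁻¹(hsiehInterpolationValue p f 𝔭 χ n A Ω_K' 1) · Ω_p'^{4n}` at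
`T = r(γ) − 1` — i.e. "Hsieh's element `Q ∈ Z̄_p⟦Γ⁻⟧` [arXiv:1112.1580 p. 3 l. 28, p. 7 l. 36],
period `Ω_p ∈ Z̄_p^×` [p. 23 ll. 63–66] and unit `C(π,λ) ∈ Z̄_{(p)}^×` [p. 4 l. 18] are, up to the
admissible re-normalisation `(Ω_K, Ω_p, Q) ↦ (Ω_K', Ω_p', C⁻¹·Q·…)`, `R₀ = 𝒪(ℚ̂_p^ur)`-rational"
(printed only by Castella–Hsieh 2018 Def. 3.5 under `p ∤ N` and Castella 2018 Thm. 3.1 for `p ≥ 5`,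
`E[p]` irreducible, `E` semistable; Hsieh's proof runs over `𝓦 = W(𝔽̄_p)[λ]` [p. 21 l. 30]). By
`X11b.Three.hsiehDisplay_of_isBDPLFunction` (stated at `3`, proof prime-generic) asking for this
frame is asking for EXACTLY a tree frame with `Ω_p ∈ R₀ˣ`, `L ∈ R₀⟦T⟧` — the `R₀`-descent, not a
new interpolation property. TYPED, not attempted; nothing asserted; consumed as a hypothesis.
[cite: Hsieh2014, Thm. 1 (arXiv:1112.1580 pp. 3–4) (frame of the antecedent; the R₀-descent at p ∣ N for reducible E[p] is NOT in print)]
[cite: CastellaHsieh2018, Def. 3.5 and Prop. 3.6 (arXiv:1505.08165 pp. 10–11) (shape of the consequent, printed for p ∤ N)]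
[cite: Castella2018, Thm. 3.1 (arXiv:1704.06608 p. 9) (shape of the consequent, printed for p ≥ 5, E[p] irreducible)] -/
@[conjecture]
def HsiehFrameResidualAt : Prop :=
  ∀ (ι' : PadicAlgCl p ≃+* ℂ) (K : Type) [Field K] [NumberField K]
    (𝔭 : HeightOneSpectrum (𝓞 K)) (κ : ZpExtension K p) (γ : Field.absoluteGaloisGroup K)
    {N : ℕ} [NeZero N] {f : CuspForm (CongruenceSubgroup.Gamma0 N) 2}, IsNewformOf W f →
    ClassX2 W p → ¬ W.HasSplitMultiplicativeReductionAtPrime p → W.conductorNorm ℤ = N →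
    IsImaginaryQuadratic K → SatisfiesHeegnerHypothesis N K →
    ((p : ℕ) : 𝓞 K) ∈ 𝔭.asIdeal →
    𝔭.asIdeal.ramificationIdx (𝓞 ℚ) = 1 → 𝔭.asIdeal.inertiaDeg (𝓞 ℚ) = 1 →
    (∀ (w : InfinitePlace K) (k : 𝓞 K), k ∈ 𝔭.asIdeal ↔ ‖ι'.symm (w.embedding (k : K))‖ < 1) →
    κ.IsAnticyclotomic → κ.IsTopGenerator γ →
    ∃ (lam : HeckeCharacter K) (rlam : FramedGaloisRep K (PadicAlgCl p) 1),
      lam.IsUnitary ∧ lam.HasInfinityType (fun _ ↦ (1 : ℤ)) (fun _ ↦ (-1 : ℤ)) ∧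
      (∀ x : ideleGroup ℚ, lam (AdeleRing.ideleBaseChange ℚ K x) = 1) ∧
      (∀ v : HeightOneSpectrum (𝓞 K), ((p : ℕ) : 𝓞 K) ∉ v.asIdeal → lam.IsUnramifiedAt v) ∧
      IsPAdicAvatarOf ι' lam rlam ∧ FactorsThroughZp κ rlam ∧
      ∀ (A : ℝ) (ΩK C : ℂ) (Ωp : ℂ_[p]) (Q : PowerSeries (PadicComplexInt p)),
        0 < A → ΩK ≠ 0 → ‖((ι'.symm C : PadicAlgCl p) : ℂ_[p])‖ = 1 → ‖Ωp‖ = 1 →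
        IsHsiehLFunction ι' 𝔭 κ γ f A ΩK C Ωp Q →
        ∃ (ΩK' : ℂ) (Ωp' : (unrIntegers p)ˣ) (L : UnrSeries p), ΩK' ≠ 0 ∧
          ∀ (χ : HeckeCharacter K) (n : ℕ), 0 < n →
            (∀ v : HeightOneSpectrum (𝓞 K), χ.IsUnramifiedAt v) →
            χ.HasInfinityType (fun _ ↦ (n : ℤ)) (fun _ ↦ -(n : ℤ)) →
            ∀ r : FramedGaloisRep K (PadicAlgCl p) 1, IsPAdicAvatarOf ι' χ r → FactorsThroughZp κ r →
              L.HasValueAt (avatarValueAt r γ - 1)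
                (((ι'.symm (hsiehInterpolationValue p f 𝔭 χ n A ΩK' 1) : PadicAlgCl p) : ℂ_[p]) *
                  ((Ωp' : unrIntegers p) : ℂ_[p]) ^ (4 * n))

end Residual

/-! ### Glue (g1) at a general prime: Hsieh's display ⟹ `IsBDPLFunction` at a rescaled period -/

section Glue

variable (p : ℕ) [Fact p.Prime] {K : Type} [Field K] [NumberField K] {N : ℕ}

/-- **From an `R₀`-frame realising HSIEH's display to `IsBDPLFunction`, every prime `p ∣ N`**
(x11b3's glue (g1) `X11b.Three.exists_isBDPLFunction_of_hsiehDisplay`, whose statement is at `3` and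
whose proof is prime-generic): if `L ∈ R₀⟦T⟧` takes at every `χ` of the range the value
`ι'⁻¹(hsiehInterpolationValue p f 𝔭 χ n A Ω_K' 1)·Ω_p'^{4n}` with `A > 0`, `Ω_K' ≠ 0` and `p ∣ N`, then
`IsBDPLFunction ι' 𝔭 κ γ f Ω_K₁ Ω_p' L` for `Ω_K₁ = (16A²/p)^{1/4}·Ω_K' ≠ 0` — Hsieh's archimedean
factor and the Steinberg `p^{n}` differ from Castella's by the REAL monomial `(p/(16A²))^{n}`,
absorbed by the complex period (`hsiehInterpolationValue_eq_bdpInterpolationValue_rescale`).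
[cite: Hsieh2014, Thm. 1 (arXiv:1112.1580 p. 4)] [cite: Castella2018, Thm. 3.1 (arXiv:1704.06608 p. 9)] -/
theorem exists_isBDPLFunction_of_hsiehDisplay (ι' : PadicAlgCl p ≃+* ℂ)
    (𝔭 : HeightOneSpectrum (𝓞 K)) (κ : ZpExtension K p) (γ : Field.absoluteGaloisGroup K) [NeZero N]
    (f : CuspForm (CongruenceSubgroup.Gamma0 N) 2) (hpN : p ∣ N) {A : ℝ} (hA : 0 < A) {ΩK' : ℂ}
    (hΩK' : ΩK' ≠ 0) (Ωp' : ℂ_[p]) (L : UnrSeries p)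
    (hL : ∀ (χ : HeckeCharacter K) (n : ℕ), 0 < n →
      (∀ v : HeightOneSpectrum (𝓞 K), χ.IsUnramifiedAt v) →
      χ.HasInfinityType (fun _ ↦ (n : ℤ)) (fun _ ↦ -(n : ℤ)) →
      ∀ r : FramedGaloisRep K (PadicAlgCl p) 1, IsPAdicAvatarOf ι' χ r → FactorsThroughZp κ r →
        L.HasValueAt (avatarValueAt r γ - 1)
          (((ι'.symm (hsiehInterpolationValue p f 𝔭 χ n A ΩK' 1) : PadicAlgCl p) : ℂ_[p]) *
            Ωp' ^ (4 * n))) :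
    ∃ ΩK₁ : ℂ, ΩK₁ ≠ 0 ∧ IsBDPLFunction ι' 𝔭 κ γ f ΩK₁ Ωp' L := by
  have hp : (p : ℕ).Prime := Fact.out
  have hp0 : (0 : ℝ) < (p : ℝ) := by exact_mod_cast hp.pos
  have hpC : (p : ℂ) ≠ 0 := by exact_mod_cast hp.ne_zero
  obtain ⟨c, hc, hc4⟩ :=
    X11b.Three.exists_pos_pow_four_eq (x := 16 * A ^ 2 / (p : ℝ)) (div_pos (by positivity) hp0)
  have hcC : (c : ℂ) ≠ 0 := Complex.ofReal_ne_zero.mpr hc.ne'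
  have hc4C : (c : ℂ) ^ 4 = 16 * (A : ℂ) ^ 2 / (p : ℂ) := by
    have := congrArg (fun t : ℝ ↦ (t : ℂ)) hc4
    push_cast at this ⊢
    exact this
  refine ⟨(c : ℂ) * ΩK', mul_ne_zero hcC hΩK', ?_⟩
  intro χ n hn hunr hinf r hr hκ
  have h := hL χ n hn hunr hinf r hr hκ
  rwa [X11b.Three.hsiehInterpolationValue_eq_bdpInterpolationValue_rescale hpN hpC f 𝔭 χ n hA.ne'
    ΩK' (c : ℂ) hcC hc4C] at h

end Glue

/-! ### H1 DISCHARGED modulo (Hsieh 2014 Thm. 1, the residual) at an X2 ∩ {non-split} datum -/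

section Existence

variable (W : WeierstrassCurve ℚ) [W.IsElliptic] [W.IsGloballyMinimal] (p : ℕ) [Fact p.Prime]

omit [W.IsGloballyMinimal] in
/-- **`hsieh2014_exists_anticyclotomicPAdicLFunction ∧ HsiehFrameResidualAt W p ⟹` a frame with
`IsBDPLFunction` EXISTS at every X2 ∩ {non-split} datum** (x11b3's `bdpExistsAt₃_of_hsieh2014`,
uniform in the odd prime). Hsieh's theorem is fed with: `p ≠ 2` and `p` multiplicative from
`ClassX2 W p` (so `p² ∤ N = N_E`, `X2.not_sq_dvd_conductorNorm_of_mult`), `IsNewformOf W f ⇒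
IsNewform0 f`, `p` split in `K` from the classical Heegner hypothesis (`p ∣ N`), `𝔭 ∋ p`, `ι'`
inducing `𝔭`, `κ` anticyclotomic with generator `γ`, and the residual's `(λ, r_λ)`; the residual turns
the witness `(A, Ω_K, C, Ω_p, Q)` into an `R₀`-frame in Hsieh's display; the glue rescales the period.
NO irreducibility, NO square-freeness, NO `p ≥ 5` enters. CONDITIONAL on the named fact `hH`
(Hsieh 2014 Thm. 1, published) and the named residual `hres` (NOT in print); nothing booked.
[cite: Hsieh2014, Thm. 1 (arXiv:1112.1580 pp. 3–4)] -/
theorem exists_isBDPLFunction_of_hsieh2014_of_not_split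
    (hH : hsieh2014_exists_anticyclotomicPAdicLFunction) (hres : HsiehFrameResidualAt W p)
    (ι' : PadicAlgCl p ≃+* ℂ) {K : Type} [Field K] [NumberField K]
    (𝔭 : HeightOneSpectrum (𝓞 K)) (κ : ZpExtension K p) (γ : Field.absoluteGaloisGroup K)
    {N : ℕ} [NeZero N] {f : CuspForm (CongruenceSubgroup.Gamma0 N) 2} (hfW : IsNewformOf W f)
    (hX : ClassX2 W p) (hns : ¬ W.HasSplitMultiplicativeReductionAtPrime p)
    (hN : W.conductorNorm ℤ = N) (hK : IsImaginaryQuadratic K) (hHN : SatisfiesHeegnerHypothesis N K)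
    (h𝔭 : ((p : ℕ) : 𝓞 K) ∈ 𝔭.asIdeal) (he : 𝔭.asIdeal.ramificationIdx (𝓞 ℚ) = 1)
    (hf : 𝔭.asIdeal.inertiaDeg (𝓞 ℚ) = 1)
    (hι' : ∀ (w : InfinitePlace K) (k : 𝓞 K), k ∈ 𝔭.asIdeal ↔ ‖ι'.symm (w.embedding (k : K))‖ < 1)
    (hκ : κ.IsAnticyclotomic) (hγ : κ.IsTopGenerator γ) :
    ∃ (ΩK : ℂ) (Ωp : (unrIntegers p)ˣ) (L : UnrSeries p),
      ΩK ≠ 0 ∧ IsBDPLFunction ι' 𝔭 κ γ f ΩK ((Ωp : unrIntegers p) : ℂ_[p]) L := by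
  obtain ⟨lam, rlam, hunit, hinfl, hAQ, hunrl, havl, hfacl, hR⟩ :=
    hres ι' K 𝔭 κ γ hfW hX hns hN hK hHN h𝔭 he hf hι' hκ hγ
  have hpN : p ∣ N := hN ▸ X11b.dvd_conductorNorm_of_mult (W := W) hX.2.2
  have hp2N : ¬ p ^ 2 ∣ N := hN ▸ _root_.Summit.BirchSwinnertonDyer.Rank1Residual.X2.not_sq_dvd_conductorNorm_of_mult W p hX.2.2
  obtain ⟨A, ΩK, C, Ωp, Q, hA, hΩK, hC, hΩp, hQ⟩ := hH ι' K 𝔭 κ γ f lam rlam hX.1 hfW.1 hp2N hK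
    (hHN p Fact.out hpN) h𝔭 hι' hHN hunit hinfl hAQ hunrl havl hfacl hκ hγ
  obtain ⟨ΩK', Ωp', L, hΩK', hL⟩ := hR A ΩK C Ωp Q hA hΩK hC hΩp hQ
  obtain ⟨ΩK₁, hΩK₁, hBDP⟩ := exists_isBDPLFunction_of_hsiehDisplay p ι' 𝔭 κ γ f hpN hA hΩK'
    ((Ωp' : unrIntegers p) : ℂ_[p]) L hL
  exact ⟨ΩK₁, Ωp', L, hΩK₁, hBDP⟩

end Existence

/-! ### The two halves QUANTIFIED OVER THE FRAME (X11b `R1.BDPValueOnTree` / `R1.IMCEqOnTree` shapes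
on the X2 ∩ {non-split} Heegner datum) -/

section HalvesOnTree

variable (W : WeierstrassCurve ℚ) [W.IsElliptic] [W.IsGloballyMinimal] (p : ℕ) [Fact p.Prime]

/-- **H2 on the X2 ∩ {non-split} Heegner datum (value at `𝟙`), typed over the frame.** For every
CGLS Heegner datum of a rank-one X2 pair at a NON-split `p` — level `N = N_E`, `K` imaginary quadratic
with `d_K < −4`, the classical Heegner hypothesis for `N`, `L(E^{d_K}, 1) ≠ 0`, Heegner datum
`(Dt, H)` with `p ∤ c` and Heegner point `P` of infinite order, anticyclotomic `(κ, γ)`, a degree-one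
`𝔭 ∋ p` —, every newform `f` of `E`, every embedding datum `ι'` inducing `𝔭`, and every frame
`(Ω_K ≠ 0, Ω_p ∈ R₀ˣ, L ∈ R₀⟦T⟧)` with `IsBDPLFunction ι' 𝔭 κ γ f Ω_K Ω_p L`:
`L(𝟙) = u·((1 − a_p(E)·p⁻¹)·log_{ω_E} P)²`, `u ∈ R₀ˣ`, `a_p(E) = W.LFunction p` (`= −1` here),
`log` through THE embedding `embAt K p 𝔭` (`R1.BDPValueAtOneOnTreeAt`). PRINT STATUS: PUB shape at
`p ≥ 5` for BOTH signs (Castella JIMJ 17 Thm. 2.11 invoked at `a_p(f) = −1`; the paper's global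
standing hypothesis (arXiv:1507.04260 p. 3) is split multiplicative; statement and proof of Thm. 2.11
are sign-independent (`a_p(f)² = p^r`, §2.4); §§1–2's only explicit `p ≥ 5` is the `E_{p−1}` ordinary
locus (§1.4); [pSI]'s prime hypothesis unchecked (acq-07302) — LIT-DOSSIER §2d(a)/§2e); NOT in print
at `p = 3 ‖ N` (`X11b.Three.BDPValueAt₃` precedent). (HK): inherits `p ∤ h_K` AS PRINTED via [Cas20]
Def. 1.3 (U1); removable by R-hK (unwritten) — TARGET §1.3 ROUTING v1.5 (4). A predicate on `(W, p)`;
TYPED, not attempted; nothing asserted; consumed as a hypothesis.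
[cite: Castella2018, Thm. 3.2 (arXiv:1704.06608 p. 9) (shape only; nothing asserted)]
[cite: Castella2018Exceptional, Thm. 2.11 (arXiv:1507.04260 p. 13) (printed value formula, p ≥ 5, p-new weight 2, either sign)] -/
@[conjecture]
def NonsplitBDPValueOnTree : Prop :=
  ∀ (N : ℕ) [NeZero N] (K : Type) [Field K] [NumberField K] (Dt : ModularParametrizationData W N)
    (H : HeegnerDatum N (NumberField.discr K)) (ιK : K →+* ℂ) (P : (W.baseChange K).toAffine.Point),
    CellC W p → ¬ W.HasSplitMultiplicativeReductionAtPrime p → W.conductorNorm ℤ = N →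
    IsImaginaryQuadratic K → NumberField.discr K < -4 → SatisfiesHeegnerHypothesis N K →
    (W.quadraticTwist (NumberField.discr K : ℚ)).entireLFunction 1 ≠ 0 →
    WeierstrassCurve.Affine.Point.map ιK.toRatAlgHom P = heegnerPointComplex Dt H →
    ¬ (p : ℤ) ∣ Dt.c → ¬ IsOfFinAddOrder P →
    ∀ (κ : ZpExtension K p), κ.IsAnticyclotomic →
      ∀ (γ : Field.absoluteGaloisGroup K) [Fact (κ.IsTopGenerator γ)]
        (𝔭 : HeightOneSpectrum (𝓞 K)) (h𝔭 : ((p : ℕ) : 𝓞 K) ∈ 𝔭.asIdeal)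
        (he : 𝔭.asIdeal.ramificationIdx (𝓞 ℚ) = 1) (hf : 𝔭.asIdeal.inertiaDeg (𝓞 ℚ) = 1),
        ∀ (f : CuspForm (CongruenceSubgroup.Gamma0 N) 2), IsNewformOf W f →
          ∀ (ι' : PadicAlgCl p ≃+* ℂ),
            (∀ (w : InfinitePlace K) (k : 𝓞 K),
              k ∈ 𝔭.asIdeal ↔ ‖ι'.symm (w.embedding (k : K))‖ < 1) →
            ∀ (ΩK : ℂ) (Ωp : (unrIntegers p)ˣ) (L : UnrSeries p), ΩK ≠ 0 →
              IsBDPLFunction ι' 𝔭 κ γ f ΩK ((Ωp : unrIntegers p) : ℂ_[p]) L →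
                R1.BDPValueAtOneOnTreeAt W p (embAt K p 𝔭 h𝔭 he hf) P L (W.LFunction p)

/-- **H3 on the X2 ∩ {non-split} Heegner datum (anticyclotomic IMC for THAT `L`), typed over the
frame.** For the same data, newform, embedding datum and frame with `IsBDPLFunction ι' 𝔭 κ γ f Ω_K
Ω_p L`: `Ch_Λ(X_ac^∅(E[p^∞]))·R₀⟦T⟧ = (L)` for the constructed `X_ac` at `𝔭` (`R1.IMCEqOnTreeAt`).
PRINT STATUS: Keller–Yin Thm. D = v2 Thm. 5.1.3 ("`(𝔛_f)Λ^ur = (𝓛_f)`" at an odd Eisenstein `p ‖ N`,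
`K` Heegner with `p` split): PREPRINT WITH GAP at L1754; the text proves D′ (μ = 0, λ-equality,
Kolyvagin-free); char-ideal form = D′ + (α) [+ (d) GAP(hypothesis) above weight `p + 1`, C–H (H)(a)
failing already at `p + 1`] or D′ + R-β; per pair D′ suffices when `ord_p log_ω P_K = 1` (void in
practice on X2c: 1/705) — bsd-eis-ky MEMO-2, REF-VERDICT-ky-MEMO-2(-ADD). (HK) as for H2. THE open
input of the non-split O9 display road in its sharpest typed form. A predicate on `(W, p)`; NEVER a
theorem in this cell; every result using it is CONDITIONAL. [claim: KellerYin2024, status: under-review] -/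
@[conjecture]
def NonsplitIMCEqOnTree : Prop :=
  ∀ (N : ℕ) [NeZero N] (K : Type) [Field K] [NumberField K] (Dt : ModularParametrizationData W N)
    (H : HeegnerDatum N (NumberField.discr K)) (ιK : K →+* ℂ) (P : (W.baseChange K).toAffine.Point),
    CellC W p → ¬ W.HasSplitMultiplicativeReductionAtPrime p → W.conductorNorm ℤ = N →
    IsImaginaryQuadratic K → NumberField.discr K < -4 → SatisfiesHeegnerHypothesis N K →
    (W.quadraticTwist (NumberField.discr K : ℚ)).entireLFunction 1 ≠ 0 →
    WeierstrassCurve.Affine.Point.map ιK.toRatAlgHom P = heegnerPointComplex Dt H →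
    ¬ (p : ℤ) ∣ Dt.c → ¬ IsOfFinAddOrder P →
    ∀ (κ : ZpExtension K p), κ.IsAnticyclotomic →
      ∀ (γ : Field.absoluteGaloisGroup K) [Fact (κ.IsTopGenerator γ)]
        (𝔭 : HeightOneSpectrum (𝓞 K)), ((p : ℕ) : 𝓞 K) ∈ 𝔭.asIdeal →
        𝔭.asIdeal.ramificationIdx (𝓞 ℚ) = 1 → 𝔭.asIdeal.inertiaDeg (𝓞 ℚ) = 1 →
        ∀ (f : CuspForm (CongruenceSubgroup.Gamma0 N) 2), IsNewformOf W f →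
          ∀ (ι' : PadicAlgCl p ≃+* ℂ),
            (∀ (w : InfinitePlace K) (k : 𝓞 K),
              k ∈ 𝔭.asIdeal ↔ ‖ι'.symm (w.embedding (k : K))‖ < 1) →
            ∀ (ΩK : ℂ) (Ωp : (unrIntegers p)ˣ) (L : UnrSeries p), ΩK ≠ 0 →
              IsBDPLFunction ι' 𝔭 κ γ f ΩK ((Ωp : unrIntegers p) : ℂ_[p]) L →
                R1.IMCEqOnTreeAt W p κ 𝔭 γ L

end HalvesOnTree

end Summit.BirchSwinnertonDyer.Rank1Residual.X2

end
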